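/-
Copyright: publication-cell `pub-balaban` (b2b), seat b2b-balaban-b10 gen 23 (v1).  Literature leaf — measure
theory (change of variables along a measurable equivalence, push-forward of a density measure), elementary calculus of
(joint) cumulant generating functions, finite sums, Euclidean isometries, and one-line applications of the lineage's
joint theorems only; every theorem is kernel-proved and tagged [folklore] or [cite: …] (a LOCATED printed shape); the
objects are MODEL OBJECTS (an abstract reference measure `dA`, a background map `τ` = "U ↦ Uᵘ", a measurable
equivalence `e` = "A ↦ R(u)A", the sibling interfaces `FluctuationModel`, `TubeCfg`, `commSpan`), never asserted to
be Bałaban's; NO new cited facts, NO summit vocabulary.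
-/
import Mathlib
import Literature.MathematicalPhysics.QuantumFieldTheory.Balaban1983to89.B10Eq24Cumulant
import Literature.MathematicalPhysics.QuantumFieldTheory.Balaban1983to89.B10Eq32SuN

/-!
# `Balaban1983to89.B10Eq26MeasureInv` — [Balaban1985UV3] (26) p. 263, THE PRINTED MECHANISM: *"It follows from
# the invariance of the expressions in (13), if we make the simultaneous transformations U₁ → U₁ᵘ, A′ → R(𝓊)A′ …
# The measure dA is invariant with respect to the orthogonal transformations A → R(𝓊)A, hence the desired
# invariance (26) follows"* — kernel-checked as a change of variables (joint invariance of the integrand +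
# invariance of the reference measure ⇒ invariance of the integral; covariance of the fluctuation measure ⇒
# invariance of every cumulant, truncated expectation, localized vertex, joint cumulant and of every functional of
# the walk-deformed generating family — *"all the expansions and expressions introduced later preserve this
# property"*), a fibred Euclidean model in which `dA`, `χ` and the Gaussian density ARE invariant, and the JOIN with
# the lineage's class-function binder `hcls` of `B10Eq31GlobalConj` / `B10Eq32SuN` (what turns (26) into `hcls`:
# covariance on the complex tube, or (26) on `G`-valued configurations + analyticity + an identity principle)

T. Bałaban, *Ultraviolet stability of three-dimensional lattice pure gauge field theories*, Commun. Math. Phys. **102**,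
255–275 (1985) [Balaban1985UV3] (cell paper B10; PDF `paper:balaban1985-cmp102-uv-stability-3d`, journal page = PDF
page + 254); T. Bałaban, *Propagators for lattice gauge theories in a background field*, Commun. Math. Phys. **99**,
389–434 (1985) [Balaban1985BackgroundPropagators] (cell paper B9 = ref. [5] of B10); T. Bałaban, *Renormalization
group approach to lattice gauge field theories. I*, Commun. Math. Phys. **109**, 249–301 (1987) [Balaban1987RG1] = [I];
*… II*, Commun. Math. Phys. **116**, 1–22 (1988) [Balaban1988RG2Cluster] = [II].  The quotations of B10 pp. 261–263
in §0 were READ AS IMAGES this generation from the renders `b2b-balaban-ref1/pages/1985-cmp102-uv-stability-3d/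
…-p007-x4.png` (p. 261), `…-p008-x4.png` (p. 262), `…-p009-x4.png` (p. 263) and `…-p020-x2.png` (p. 274, the reference
list: *"5. Balaban, T.: Propagators for lattice gauge theories in a background field. … Commun. Math. Phys. 99, 389–434
(1985)"*, *"8. Balaban, T.: (Higgs)₂,₃ quantum fields in a finite volume. I. A lower bound. Commun. Math. Phys. 85,
603–636 (1982)"*); the quotations of B9 pp. 395–396, 416 are RE-KEYED byte-for-byte from the §0 of the tree modules
`…B9Eq333Cov` (b09 gen 6) and `…B9SectDWalk`; those of B10 p. 264 and [I] p. 283 / [II] p. 21 from the §0 of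
`…B10Eq31GlobalConj` (b10 gen 21).  This module adds NO cited fact.  Siblings (imported BY NAME, byte-identical,
nothing edited): `…B10Eq24Cumulant` (`cgf`-calculus, `truncExp`, `nmoment`, `chiMeasure`, `FluctuationModel`,
`FluctuationModel.pertSum`, `FluctuationModel.CumulantRemainderBound`) and `…B10Eq32SuN` (hence `…B10Eq31GlobalConj`,
`…B10Eq29TubeLine`, `…B10Eq61PerSite`: `TubeCfg`, `conj_mem_tubeCfg`, `commSpan`, `diffAlongV`, `expLine`,
`cstarAlgebraMatrix`, `logHalfBound_expLine_cplx_of_classFn`, `classFn_of_suClassFn`,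
`mem_closure_commSpan_of_trace_eq_zero`).

WHY THIS MODULE (the b10 lineage's open edge after `B10Eq32SuN` v1: cell GAPS C-B13-32 / C-adv2-63 R1 / C-b10g19-2
(iii) — «a located `hcls` for the PRINTED pieces»; README gen 22 «How to continue (gen 23)» node 1; adv2 XREAD
C-adv2-72 R2 «`hcls` on the COMPLEX tube = (26) + analytic continuation — word it only with substance»).  Every joint
theorem of the lineage (`B10Eq61Leaves` … `B10Eq32SuN`) carries the symmetry binder
`hcls : ∀ X, ∀ W ∈ unitary 𝔸, ∀ V ∈ TubeCfg ι 𝔸 a, E X (W·V·W⋆) = E X V` — the printed (26) for the constant gauge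
transformations, read on the complex tube.  Print PROVES (26) in three sentences (p. 263, quoted below): the integrand
of the fluctuation integral is invariant under the SIMULTANEOUS change `U₁ → U₁ᵘ, A′ → R(𝓊)A′`, the later expansions
preserve this, and `dA` is `R(𝓊)`-invariant.  This module types exactly that mechanism over the sibling interfaces and
kernel-proves every implication in it, so that the `hcls` binder of a MEASURE-DEFINED family `E X V = ∫ F X V A dν_V(A)`
is DISCHARGED from two located hypotheses of the printed shape (covariance of `ν`, joint invariance of `F`; §5), and
so that the cumulant / truncated-expectation / localisation objects of `B10Eq24Cumulant` are CERTIFIED invariant under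
the same two hypotheses (§1–§3) — the sentence *"all the expansions and expressions introduced later preserve this
property"* made into theorems for every expansion the lineage has typed.

WHAT IS PRINTED (verbatim).
* B10 p. 261, (22) and after: the last factor of (22) is *"× ∫dA↾_{Ω₁} δ(QA)δ_{Ax}(A)χ exp[𝓋(g₀A) − (1/g₀²)A(U₁) +
  ⟨D̃⁽²⁾(A), J⟩ − ½⟨A, Δ(U₁)A⟩ − (1/g₀²)Ṽ₀(g₀A) − E + log σ₀|Ω₁*| + d(𝔤)log g₀|Ω₁*|]"* = *"× ∫dμ_{C⁽⁰⁾(Ω₁,U₁)}(A)χ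
  exp[𝓋(g₀A) − (1/g₀²)Ṽ(g₀A)], (22) where χ = Π_{b∈Ω₁} χ({|A(b)| < p²(g₀)}), and d(𝔤) denotes a dimension of the
  Lie algebra 𝔤. The last integral above has the form ∫μχexp V, where dμ is a Gaussian measure with a covariance
  having an exponential decay property (and many other properties, see Sect. E in [5]), and V is a sum of terms with
  good localization properties."*
* B10 p. 262: *"Next, the integral is calculated by the cumulant expansion formula (3.24) [8], again up to the sixth
  order in g₀. A result of the calculation can be represented by lower order connected vacuum graphs with vertices
  determined by the expansions of the function 𝓋(g₀A) − 1/g₀²Ṽ(g₀A). The vertices are represented by sums over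
  almost local expressions, i.e. expressions involving field variables A localized to a union of several
  neighbouring blocks. They have at most eight legs, and the graphs have at most six vertices. We analyze these
  perturbative expressions in a way similar to the analysis in [10]. We localize vertices in big blocks by a
  decomposition of unity, and we expand the propagators C⁽⁰⁾(Ω₁, U₁) into the generalized random walk expansion
  described in [5], Theorem 3.15, Theorem 3.10 and the preceding theorems. This gives a sum of expressions having
  the following structure. Each expression corresponds to a graph with vertices localized in cubes {□ᵢ}. A line of
  the graph connecting vertices □ᵢ, □ⱼ is replaced by a random walk ω = ((α₀, X₀), (α₁, X₁), …, (αₙ, Xₙ)) satisfying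
  □ᵢ ∩ X₀ ≠ ∅, X_{m−1} ∩ X_m ≠ ∅, m = 1, …, n, Xₙ ∩ □ⱼ ≠ ∅."* … *"The localizations {□ᵢ} and the walks ω replacing
  lines of the graph define a localization X of the considered expression. This localization is simply a union of
  all these sets."* … *"Summing the expressions with the same localization X we get finally the inequality"* (24) …
  *"Besides the bounds (25) the expressions 𝒫′₁ have three very important properties. The first is gauge invariance
  with respect to all gauge transformations of the configuration U₁, i.e. the following"* [p. 263] *"equalities hold
  𝒫′₁(g₀, X, U₁ᵘ) = 𝒫′₁(g₀, X, U₁), (26) for all gauge transformations 𝓊. The second is a localization property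
  with respect to U₁. The expression 𝒫′₁(g₀, X, U₁) depends on U₁ restricted to the set X̃⁵ (let us recall that
  X̃⁵ = ∪_{□⊂X} □̃⁵). The third property is the analyticity with respect to U₁. These properties follow from the
  results of previous papers; let us make a comment only on the gauge invariance (26). It follows from the invariance
  of the expressions in (13), if we make the simultaneous transformations U₁ → U₁ᵘ, A′ → R(𝓊)A′, we have to notice
  only that all the expansions and expressions introduced later preserve this property. The measure dA is invariant
  with respect to the orthogonal transformations A → R(𝓊)A, hence the desired invariance (26) follows."*
* B10 p. 264 (re-keyed from `…B10Eq31GlobalConj` §0): *"(26) holds for all regular gauge field configurations, hence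
  for U₁ = 1 also. … The gauge invariance (26) implies the invariance with respect to the global transformations
  R(U), U ∈ G"* (31).
* B9 p. 395 (re-keyed from `…B9Eq333Cov` §0): *"Let us discuss how these operators transform under gauge
  transformations of the configuration U. … if we make the transformations U → Uᵘ, U′ → R(u)U′, (3.28) where
  Uᵘ(x, x′) = u(x)U(x, x′)u⁻¹(x′), (R(u)U′)(x, x′) = R(u(x))U′(x, x′), then A^η(R(u)U′Uᵘ) = A^η((U′U)ᵘ) = A^η(U′U).
  (3.29) … Taking the polynomials of first and second order we get ⟨R(u)A, Jᵘ⟩ = ⟨A, J⟩, ⟨R(u)A, Δ^η(Uᵘ)R(u)A⟩ =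
  ⟨A, Δ^η(U)A⟩, (3.30) or Jᵘ = R(u)J, Δ^η(Uᵘ) = R(u)Δ^η(U)R(u⁻¹)."*; p. 396: *"This implies the transformation laws
  for the operators Δ_a and G  Δ_a(Uᵘ) = R(u)Δ_a(U)R(u⁻¹), G(Uᵘ) = R(u)G(U)R(u⁻¹). (3.34)"*; p. 398, after (3.47):
  *"All these inequalities are invariant with respect to gauge transformations of U"*.
* B9 Theorem 3.10 p. 416 (re-keyed from `…B9SectDWalk` §0): *"operator G has the expansion G = Σ_ω R₀(X₀)R_{α₁}(X₁)
  ·…·R_{αₙ}(Xₙ), (3.107) the sum is over walks ω = ((0,X₀),(α₁,X₁),…,(αₙ,Xₙ)) satisfying X_{i−1} ∩ X_i ≠ ∅,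
  i = 1,…,n. A term in this expansion, corresponding to a walk ω, depends on configuration U restricted to
  X̃₀⁵ ∪ X̃₁⁵ ∪ … ∪ X̃ₙ⁵"*.
* [I] p. 283 / [II] p. 21 (re-keyed from `…B10Eq31GlobalConj` §0 via `…B10Eq29CplxLine` §0): the effective
  densities are *"extended analytically"* to the complex spaces of configurations (the lineage's `TubeCfg`), on which
  the class-function binder `hcls` is read.

WHAT IS KERNEL-CERTIFIED (all [folklore] mathematics; the value is the typed skeleton of the three printed sentences
and the precise list of what they use).
(§1) THE SENTENCE ITSELF: for a reference measure `dA` on a measurable space `Ω`, a measurable equivalence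
  `e : Ω ≃ᵐ Ω` preserving `dA` (*"The measure dA is invariant"*) and an integrand `ρ U A` with
  `ρ (τ U) (e A) = ρ U A` (*"the invariance of the expressions in (13), if we make the simultaneous
  transformations"*), `∫ ρ (τ U) dA = ∫ ρ U dA` (`integral_eq_of_jointInvariant`) — (26) for an integral.  MEASURE
  FORM: push-forward of a density measure along an equivalence (`map_withDensity_equiv`, absent from Mathlib in this
  form), hence a jointly invariant density on an invariant reference measure gives a COVARIANT family
  `(ν U).map e = ν (τ U)` (`cov_withDensity_of_jointInvariant`; `cov_smul`, `cov_chiMeasure` for normalisation and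
  the small-field weight `χ`), and a covariant family integrates jointly invariant functions invariantly
  (`integral_eq_of_cov`), has invariant mass, moments `nmoment`, moment and cumulant generating functions `mgf`,
  `cgf` AS FUNCTIONS, hence invariant truncated expectations `truncExp = ⟨Vⁿ⟩ᵀ` of every order, invariant
  interpolated remainders `iteratedDeriv (N+1) (cgf …) θ` and invariant `log ∫ e^V dν` (`…_eq_of_cov`).
(§2) FOR THE STEP DICTIONARY `B10Eq24Cumulant.FluctuationModel`: under covariance of `M.ν h` and joint invariance
  of `M.V h` along a background map `τ` of `T.Cfg (k+1)`, the perturbative sum `M.pertSum h`, the quantity bounded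
  in `CumulantRemainderBound` and the fluctuation logarithm are `τ`-invariant (`FluctuationModel.pertSum_eq_of_cov`,
  `…cumulantRemainder_eq_of_cov`, `…logFluct_eq_of_cov`) — *"the integral is calculated by the cumulant expansion
  formula (3.24) [8]"* preserves the property.
(§3) *"ALL THE EXPANSIONS … PRESERVE THIS PROPERTY"*, for the two expansions print names: (a) *"We localize vertices
  in big blocks by a decomposition of unity"*: a vertex `Σ_x v U x A` split by BACKGROUND-INDEPENDENT weights
  `h □ x` into `locVertex h v U □ A = Σ_x h □ x · v U x A` stays jointly invariant for each `□` (`locVertex_jointInvariant`)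
  and resums to the vertex when `Σ_□ h □ x = 1` (`sum_locVertex`); the JOINT cumulant generating function
  `jointCgf V ν t = log ∫ exp(Σᵢ tᵢVᵢ) dν` of a jointly invariant family under a covariant measure is invariant AS A
  FUNCTION of `t` (`jointCgf_eq_of_cov`), hence so is every mixed Taylor coefficient — the joint cumulants
  `jointCumulant` = `∂ⁿ/∂t₁…∂tₙ|₀` (*"connected vacuum graphs with vertices"* `V₁, …, Vₙ`; `jointCumulant_eq_of_cov`);
  (b) *"we expand the propagators … into the generalized random walk expansion"*: a family of measures deformed by
  walk parameters `s`, `ν U s`, covariant for every `s` (located: each walk term of (3.107) transforms by (3.34),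
  so the deformed covariance `Σ_ω s_ω C_ω(U)` is conjugated by `R(u)` and its Gaussian measure pushed forward — §4
  proves the push-forward step for Lebesgue-density Gaussians) has a generating family
  `(t, s) ↦ jointCgf (W U) (ν U s) t` invariant AS A FUNCTION (`jointCgf_deformed_eq_of_cov`), hence EVERY functional
  of it — every coefficient extraction in `(t, s)`, i.e. every graph-with-walks piece and every finite sum of pieces
  *"with the same localization X"* — is invariant (`functional_deformed_eq_of_cov`).  The identification «piece of
  the expansion = mixed Taylor coefficient of the deformed generating family» (Wick's theorem / multilinearity of
  graph values in the propagators) is the [folklore] DICTIONARY under which (b) is read; it is NOT kernel-proved here.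
(§4) A FIBRED EUCLIDEAN MODEL in which the two hypotheses of §1 are THEOREMS: fields `A : B → F` on a finite bond set
  with values in a finite-dimensional real inner-product space (`𝔤` with the Killing form), `R(u)` = a bondwise
  linear isometry `rot L`, `(rot L A) b = L b (A b)` — Lebesgue measure is preserved (`measurePreserving_rot`: *"dA is
  invariant with respect to the orthogonal transformations"*), the small-field weight `χ = Π_b χ({|A(b)| < p})` is
  invariant (`chiSmall_rot`), a quadratic form `⟨A, Δ(U)A⟩` with `Δ (τ U) ∘ rot L = rot L ∘ Δ U` ((3.30)/(3.34) in the
  intertwining form of `B9Eq333Cov`) is jointly invariant (`quadForm_jointInvariant`), hence the (22)-shaped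
  integrand `exp(−½⟨A,Δ(U)A⟩)·χ(A)·exp(V U A)` is jointly invariant for jointly invariant `V` and ITS INTEGRAL
  AGAINST LEBESGUE MEASURE SATISFIES (26) WITH NO HYPOTHESIS ON THE MEASURE (`integral_fluctIntegrand_eq`); the
  Gaussian density measure and its `χ`-weighting are covariant families (`cov_gaussDensity`, `cov_gaussChi`); Mathlib's
  standard Gaussian is preserved by every linear isometry (`measurePreserving_stdGaussian`).
(§5) THE JOIN.  For a measure-defined localized family `measE ν F X V = ∫ F X V A dν_V(A)` over configurations
  `V : ι → 𝔸` (`𝔸` a unital C⋆-algebra, the lineage's model) and transformations `e W : Ω ≃ᵐ Ω` indexed by the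
  unitaries `W`: (J-0) covariance of `ν` and joint invariance of `F` on UNITARY-valued configurations give (26)
  literally — invariance of `measE ν F X` under `V ↦ (W·V_b·W⋆)_b` on unitary-valued `V` (`unitaryClassFn_measE_of_cov`);
  (J-a) the same two hypotheses on the complex tube `TubeCfg ι 𝔸 a` (which the conjugations preserve,
  `conj_mem_tubeCfg`) give the lineage's binder `hcls` VERBATIM (`classFn_measE_of_cov`), whence
  `B13.LogHalfBound` for the differenced (61)-pieces by `logHalfBound_expLine_cplx_of_classFn` with `hcls`
  DISCHARGED (`logHalfBound_expLine_cplx_of_cov`) and its `SU(N)` form (`logHalfBound_expLine_cplx_of_suCov`, via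
  `classFn_of_suClassFn` + `mem_closure_commSpan_of_trace_eq_zero`); (J-b) alternatively, (26) on unitary-valued
  configurations + holomorphy on the tube (the printed *"third property"*) + an IDENTITY PRINCIPLE along the unitary
  slice (`TubeIdentity`, a named [folklore] hypothesis shape — the located «extended analytically» step of [I] p. 283,
  adv2 C-adv2-72 R2) give `hcls` (`classFn_of_unitaryClassFn`).
(§6) NON-VACUITY: (T1) on any finite-dimensional inner-product space the weight `exp(−‖A‖²)cos⟪n, A⟫` with background
  `n` is jointly invariant under `(n, A) ↦ (Ln, LA)` for every linear isometry `L`, so `∫ exp(−‖A‖²)cos⟪Ln, A⟫ dA =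
  ∫ exp(−‖A‖²)cos⟪n, A⟫ dA` by §1 with both hypotheses PROVED (`example_integral_rot`); (T2) the hypotheses of (J-a)
  hold simultaneously and non-trivially for `Ω = 𝔸`, `e W = (A ↦ W A W⋆)`, `ν V = δ_{V b₀ · V b₁}`,
  `F X V A = ‖A − V b₀‖` (`example_classFn_measE`).

HYPOTHESIS SHAPES (located, never asserted; each is a binder of the theorems, in print's words).
(H1) `he : MeasurePreserving e dA dA` — *"The measure dA is invariant with respect to the orthogonal transformations
  A → R(𝓊)A"* (B10 p. 263); a THEOREM in the fibred model of §4.  (H2) `hρ / hV / hF : f (τ U) (e A) = f U A` —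
  *"the invariance of the expressions in (13), if we make the simultaneous transformations U₁ → U₁ᵘ, A′ → R(𝓊)A′"*
  (B10 p. 263; B9 (3.29)–(3.30)).  (H3) `hν : (ν U).map e = ν (τ U)` — covariance of the fluctuation measure
  `dμ_{C⁽⁰⁾(Ω₁,U₁)}χ`: by §1/§4 a CONSEQUENCE of (H1) + (H2) for the Gaussian density ((3.30): *"⟨R(u)A, Δ^η(Uᵘ)R(u)A⟩
  = ⟨A, Δ^η(U)A⟩"*) and for `χ`.  (H4) `hΔ : Δ (τ U) (rot L A) = rot L (Δ U A)` — (3.30)/(3.34) in intertwining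
  form (as typed in `B9Eq333Cov`).  (H5) covariance of the walk-deformed family `ν U s` for every `s` — (3.34) for each
  local operator of a walk term of (3.107) + (H1).  (H6) `TubeIdentity` — [folklore] identity principle (a function
  holomorphic on the bondwise tube and vanishing on the unitary-valued configurations vanishes on the tube; the
  unitary group is a totally real slice of maximal dimension), the located «extended analytically» step.

HONEST SCOPE.  (i) A MODEL: nothing of Bałaban's `dA`, `χ`, `Δ(U₁)`, `C⁽⁰⁾`, `𝓋`, `Ṽ`, `𝒫′₁` is constructed; the
theorems say what the three printed sentences GIVE once their two inputs (H1), (H2) hold, and §4 shows (H1) and the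
`χ`/Gaussian parts of (H2)/(H3) holding in the natural Euclidean model.  (ii) (26) is printed for `G`-valued
configurations `U₁` and ALL gauge transformations `𝓊` (site-dependent); the lineage's `hcls` needs only the CONSTANT
ones (`𝓊 ≡ W`), but on the COMPLEX tube: (J-a) hypothesises (H2)/(H3) on the tube (print's mechanism read verbatim
on the analytically continued densities), (J-b) isolates the continuation as (H6); neither is discharged from print
here.  Site-dependent `𝓊` is modelled in §4 only through the bondwise isometry family `L b` (for `R(𝓊)` acting on
`A(b)` through `𝓊` at the initial point of `b`, (3.28)).  (iii) The gauge-fixing factor `δ(QA)δ_{Ax}(A)` of (22)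
(restriction of `dA` to a linear subspace, itself `R(𝓊)`-covariant) is absorbed in the abstract `dA` of §1 and NOT
modelled in §4.  (iv) §3(b) certifies invariance of the deformed generating family and of every functional of it;
that the printed graph-with-walks pieces ARE such functionals is the [folklore] Wick/multilinearity dictionary, not
kernel-proved; likewise *"sums over almost local expressions"* are modelled only as finite sums (§3(a)).  (v) No
bound, no convergence, no (23)–(25): invariance only.  (vi) Not summit progress, not a continuum statement, not Clay
progress; the cell GAPS rows C-B13-32 / C-adv2-63 / C-b10g19-2 (iii) move from «hypothesis shape» to «discharged from
two located measure-level hypotheses, themselves theorems in the Euclidean model» — no further.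

RECORDS: cell GAPS C-b10g23-1 (this module), C-B13-32 UPDATE (b10-g23); DIVERGENCE D-b10.28; no new bib key (keys used:
Balaban1985UV3, Balaban1985BackgroundPropagators, Balaban1987RG1, Balaban1988RG2Cluster, all in references.bib).
-/

open MeasureTheory ProbabilityTheory
open scoped ENNReal RealInnerProductSpace

namespace Literature.MathematicalPhysics.QuantumFieldTheory.Balaban1983to89.B10Eq26MeasureInv

open B10Eq24Cumulant (truncExp truncExp_def nmoment chiMeasure FluctuationModel)
open B10Eq61PerSite (diffAlongV)
open B10Eq29TubeLine (Tube TubeCfg expLine cstarAlgebraMatrix)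
open B10Eq31GlobalConj (conj_mem_tubeCfg commSpan logHalfBound_expLine_cplx_of_classFn)
open B10Eq32SuN (classFn_of_suClassFn mem_closure_commSpan_of_trace_eq_zero)

/-! ## §1. [folklore] The printed sentence as a change of variables; covariant families of measures and the
## invariance of everything the cumulant expansion is made of -/

section Mechanism

variable {𝔘 Ω : Type*} [MeasurableSpace Ω] {G : Type*} [NormedAddCommGroup G] [NormedSpace ℝ G]

/-- **THE PRINTED MECHANISM OF (26)** — *"It follows from the invariance of the expressions in (13), if we make the
simultaneous transformations U₁ → U₁ᵘ, A′ → R(𝓊)A′ … The measure dA is invariant with respect to the orthogonal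
transformations A → R(𝓊)A, hence the desired invariance (26) follows"*: an integrand jointly invariant under the
background map `τ` ("U ↦ Uᵘ") and a measurable equivalence `e` ("A ↦ R(𝓊)A") preserving the reference measure has a
`τ`-invariant integral.  Vector-valued (covers real and complex integrands).
[cite: Balaban1985UV3, (26) p.263 (the three sentences after (26))] -/
theorem integral_eq_of_jointInvariant {dA : Measure Ω} {τ : 𝔘 → 𝔘} {e : Ω ≃ᵐ Ω}
    (he : MeasurePreserving e dA dA) {ρ : 𝔘 → Ω → G} (hρ : ∀ U A, ρ (τ U) (e A) = ρ U A) (U : 𝔘) :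
    ∫ A, ρ (τ U) A ∂dA = ∫ A, ρ U A ∂dA := by
  rw [← he.integral_comp' (ρ (τ U))]
  simp only [hρ]

/-- The same for the lower integral of an extended-non-negative integrand (masses, normalisers). [folklore] -/
theorem lintegral_eq_of_jointInvariant {dA : Measure Ω} {τ : 𝔘 → 𝔘} {e : Ω ≃ᵐ Ω}
    (he : MeasurePreserving e dA dA) {w : 𝔘 → Ω → ℝ≥0∞} (hw : ∀ U A, w (τ U) (e A) = w U A) (U : 𝔘) :
    ∫⁻ A, w (τ U) A ∂dA = ∫⁻ A, w U A ∂dA := by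
  rw [← he.lintegral_comp_emb e.measurableEmbedding (w (τ U))]
  simp only [hw]

/-- Push-forward of a density measure along a measurable equivalence: `(f·μ).map e = (f ∘ e⁻¹)·(μ.map e)` (Mathlib
has the Jacobian versions, not this equivalence form). [folklore] -/
theorem map_withDensity_equiv {α β : Type*} [MeasurableSpace α] [MeasurableSpace β] (μ : Measure α)
    (f : α → ℝ≥0∞) (e : α ≃ᵐ β) :
    (μ.withDensity f).map e = (μ.map e).withDensity (f ∘ e.symm) := by
  ext s hs
  rw [e.map_apply, withDensity_apply _ (e.measurable hs), withDensity_apply _ hs,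
    e.measurableEmbedding.restrict_map, lintegral_map_equiv]
  simp only [Function.comp_apply, e.symm_apply_apply]

/-- … in particular along an equivalence preserving `μ`: `(f·μ).map e = (f ∘ e⁻¹)·μ`. [folklore] -/
theorem map_withDensity_of_map_eq {μ : Measure Ω} {e : Ω ≃ᵐ Ω} (he : μ.map e = μ) (f : Ω → ℝ≥0∞) :
    (μ.withDensity f).map e = μ.withDensity (f ∘ e.symm) := by
  rw [map_withDensity_equiv, he]

/-- **MEASURE FORM OF THE PRINTED SENTENCE**: a density `w U` jointly invariant under `(τ, e)` on an `e`-invariant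
reference measure `dA` defines a COVARIANT family, `(w U · dA).map e = w (τ U) · dA` — the fluctuation measure
`dμ_{C⁽⁰⁾(Ω₁,U₁)}(A)χ` of (22) transported by `A → R(𝓊)A` is the fluctuation measure at `U₁ᵘ`.
[cite: Balaban1985UV3, (22) p.261, (26) p.263; Balaban1985BackgroundPropagators, (3.30) p.395] -/
theorem cov_withDensity_of_jointInvariant {dA : Measure Ω} {τ : 𝔘 → 𝔘} {e : Ω ≃ᵐ Ω}
    (he : MeasurePreserving e dA dA) {w : 𝔘 → Ω → ℝ≥0∞} (hw : ∀ U A, w (τ U) (e A) = w U A) (U : 𝔘) :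
    (dA.withDensity (w U)).map e = dA.withDensity (w (τ U)) := by
  rw [map_withDensity_of_map_eq he.map_eq]
  congr 1
  funext A
  simp only [Function.comp_apply]
  rw [← hw U (e.symm A), e.apply_symm_apply]

/-- A covariant family integrates jointly invariant (vector-valued) functions invariantly:
`∫ f (τ U) dν_{τ U} = ∫ f U dν_U`. [folklore] -/
theorem integral_eq_of_cov {ν : 𝔘 → Measure Ω} {τ : 𝔘 → 𝔘} {e : Ω ≃ᵐ Ω}
    (hν : ∀ U, (ν U).map e = ν (τ U)) {f : 𝔘 → Ω → G} (hf : ∀ U A, f (τ U) (e A) = f U A) (U : 𝔘) :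
    ∫ A, f (τ U) A ∂(ν (τ U)) = ∫ A, f U A ∂(ν U) := by
  rw [← hν U, integral_map_equiv]
  simp only [hf]

/-- A covariant family has invariant total mass (the small-field volume `⟨χ⟩`, `B10Eq24Cumulant.SmallFieldVolume`).
[folklore] -/
theorem measureReal_univ_eq_of_cov {ν : 𝔘 → Measure Ω} {τ : 𝔘 → 𝔘} {e : Ω ≃ᵐ Ω}
    (hν : ∀ U, (ν U).map e = ν (τ U)) (U : 𝔘) :
    (ν (τ U)).real Set.univ = (ν U).real Set.univ := by
  simp only [← hν U, measureReal_def, e.map_apply, Set.preimage_univ]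

/-- Covariance survives an invariant scalar factor (normalisation `Z(U)⁻¹`, with `Z(Uᵘ) = Z(U)` by
`lintegral_eq_of_jointInvariant`). [folklore] -/
theorem cov_smul {ν : 𝔘 → Measure Ω} {τ : 𝔘 → 𝔘} {e : Ω ≃ᵐ Ω}
    (hν : ∀ U, (ν U).map e = ν (τ U)) {c : 𝔘 → ℝ≥0∞} (hc : ∀ U, c (τ U) = c U) (U : 𝔘) :
    (c U • ν U).map e = c (τ U) • ν (τ U) := by
  rw [Measure.map_smul, hν U, hc U]

/-- Covariance survives a jointly invariant real weight — the small-field characteristic function `χ` of (22) in the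
sibling's `chiMeasure` form (`B10Eq24Cumulant` §4). [cite: Balaban1985UV3, (22) p.261 («where χ = Π_{b∈Ω₁} χ({|A(b)| < p²(g₀)})»)] -/
theorem cov_chiMeasure {ν : 𝔘 → Measure Ω} {τ : 𝔘 → 𝔘} {e : Ω ≃ᵐ Ω}
    (hν : ∀ U, (ν U).map e = ν (τ U)) {χ : 𝔘 → Ω → ℝ} (hχ : ∀ U A, χ (τ U) (e A) = χ U A) (U : 𝔘) :
    (chiMeasure (ν U) (χ U)).map e = chiMeasure (ν (τ U)) (χ (τ U)) := by
  simp only [chiMeasure]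
  rw [map_withDensity_equiv, hν U]
  congr 1
  funext A
  simp only [Function.comp_apply]
  rw [← hχ U (e.symm A), e.apply_symm_apply]

/-- The normalised moments `⟨Vⁿ⟩` (`B10Eq24Cumulant.nmoment`) of a jointly invariant potential under a covariant
family are invariant. [folklore] -/
theorem nmoment_eq_of_cov {ν : 𝔘 → Measure Ω} {τ : 𝔘 → 𝔘} {e : Ω ≃ᵐ Ω}
    (hν : ∀ U, (ν U).map e = ν (τ U)) {V : 𝔘 → Ω → ℝ} (hV : ∀ U A, V (τ U) (e A) = V U A) (U : 𝔘) (n : ℕ) :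
    nmoment (V (τ U)) (ν (τ U)) n = nmoment (V U) (ν U) n := by
  simp only [nmoment]
  rw [measureReal_univ_eq_of_cov hν U, ← hν U, integral_map_equiv]
  simp only [hV]

/-- The moment generating function `t ↦ ∫ e^{tV} dν` is invariant AS A FUNCTION. [folklore] -/
theorem mgf_eq_of_cov {ν : 𝔘 → Measure Ω} {τ : 𝔘 → 𝔘} {e : Ω ≃ᵐ Ω}
    (hν : ∀ U, (ν U).map e = ν (τ U)) {V : 𝔘 → Ω → ℝ} (hV : ∀ U A, V (τ U) (e A) = V U A) (U : 𝔘) :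
    mgf (V (τ U)) (ν (τ U)) = mgf (V U) (ν U) := by
  funext t
  simp only [mgf]
  rw [← hν U, integral_map_equiv]
  simp only [hV]

/-- The cumulant generating function `t ↦ log ∫ e^{tV} dν` is invariant AS A FUNCTION — hence so is every Taylor
coefficient: *"the integral is calculated by the cumulant expansion formula (3.24) [8]"* preserves the property.
[cite: Balaban1985UV3, p.262 (first paragraph) + (26) p.263] -/
theorem cgf_eq_of_cov {ν : 𝔘 → Measure Ω} {τ : 𝔘 → 𝔘} {e : Ω ≃ᵐ Ω}
    (hν : ∀ U, (ν U).map e = ν (τ U)) {V : 𝔘 → Ω → ℝ} (hV : ∀ U A, V (τ U) (e A) = V U A) (U : 𝔘) :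
    cgf (V (τ U)) (ν (τ U)) = cgf (V U) (ν U) := by
  funext t
  rw [cgf, cgf, mgf_eq_of_cov hν hV U]

/-- Every truncated expectation `⟨Vⁿ⟩ᵀ` (`B10Eq24Cumulant.truncExp`, B1 (3.23)) is invariant. [folklore] -/
theorem truncExp_eq_of_cov {ν : 𝔘 → Measure Ω} {τ : 𝔘 → 𝔘} {e : Ω ≃ᵐ Ω}
    (hν : ∀ U, (ν U).map e = ν (τ U)) {V : 𝔘 → Ω → ℝ} (hV : ∀ U A, V (τ U) (e A) = V U A) (U : 𝔘) (n : ℕ) :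
    truncExp (V (τ U)) (ν (τ U)) n = truncExp (V U) (ν U) n := by
  rw [truncExp_def, truncExp_def, cgf_eq_of_cov hν hV U]

/-- Every interpolated derivative `(d/dθ)ⁿ log ∫ e^{θV} dν` — the quantity bounded by the cumulant-remainder leaf
`B10Eq24Cumulant.FluctuationModel.CumulantRemainderBound` — is invariant. [folklore] -/
theorem iteratedDeriv_cgf_eq_of_cov {ν : 𝔘 → Measure Ω} {τ : 𝔘 → 𝔘} {e : Ω ≃ᵐ Ω}
    (hν : ∀ U, (ν U).map e = ν (τ U)) {V : 𝔘 → Ω → ℝ} (hV : ∀ U A, V (τ U) (e A) = V U A) (U : 𝔘) (n : ℕ)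
    (θ : ℝ) : iteratedDeriv n (cgf (V (τ U)) (ν (τ U))) θ = iteratedDeriv n (cgf (V U) (ν U)) θ := by
  rw [cgf_eq_of_cov hν hV U]

/-- The fluctuation logarithm `log ∫ e^{V} dν` (the (22)/(58) integral in `FluctuationModel.logFl_le / le_logFl`) is
invariant. [cite: Balaban1985UV3, (22) p.261, (26) p.263] -/
theorem log_integral_exp_eq_of_cov {ν : 𝔘 → Measure Ω} {τ : 𝔘 → 𝔘} {e : Ω ≃ᵐ Ω}
    (hν : ∀ U, (ν U).map e = ν (τ U)) {V : 𝔘 → Ω → ℝ} (hV : ∀ U A, V (τ U) (e A) = V U A) (U : 𝔘) :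
    Real.log (∫ A, Real.exp (V (τ U) A) ∂(ν (τ U))) = Real.log (∫ A, Real.exp (V U A) ∂(ν U)) := by
  rw [← hν U, integral_map_equiv]
  simp only [hV]

end Mechanism

/-! ## §2. The step dictionary `B10Eq24Cumulant.FluctuationModel`: the perturbative sum, the cumulant remainder and
## the fluctuation logarithm are invariant under a covariant background map -/

section Step

open B10 B10SectAGathering

variable {T : TowerRun} {k : ℕ} {P : StepPieces T k} {Ω : Type*} [MeasurableSpace Ω]
  (M : FluctuationModel P Ω) {τ : T.Cfg (k + 1) → T.Cfg (k + 1)} {e : Ω ≃ᵐ Ω}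

/-- Under covariance of the step's fluctuation measures `M.ν h` and joint invariance of its potentials `M.V h` along
a background map `τ` (the gauge transformation `U ↦ Uᵘ` of the level-(k+1) configurations), the order-`N`
perturbative sum `Σ_{n ≤ N} ⟨Vⁿ⟩ᵀ/n!` is `τ`-invariant — (26) summed over `X` at cumulant level, before localisation.
[cite: Balaban1985UV3, p.262 (first paragraph), (26) p.263, (59) p.270] -/
theorem FluctuationModel.pertSum_eq_of_cov (hν : ∀ h U, (M.ν h U).map e = M.ν h (τ U))
    (hV : ∀ h U A, M.V h (τ U) (e A) = M.V h U A) (h : T.Hist (k + 1)) (U : T.Cfg (k + 1)) :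
    M.pertSum h (τ U) = M.pertSum h U := by
  simp only [FluctuationModel.pertSum, truncExp_eq_of_cov (hν h) (hV h) U]

/-- … the interpolated `(N+1)`-st cumulant of `CumulantRemainderBound` is `τ`-invariant … [folklore] -/
theorem FluctuationModel.cumulantRemainder_eq_of_cov (hν : ∀ h U, (M.ν h U).map e = M.ν h (τ U))
    (hV : ∀ h U A, M.V h (τ U) (e A) = M.V h U A) (h : T.Hist (k + 1)) (U : T.Cfg (k + 1)) (θ : ℝ) :
    iteratedDeriv (M.N + 1) (cgf (M.V h (τ U)) (M.ν h (τ U))) θ =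
      iteratedDeriv (M.N + 1) (cgf (M.V h U) (M.ν h U)) θ :=
  iteratedDeriv_cgf_eq_of_cov (hν h) (hV h) U (M.N + 1) θ

/-- … and so is the fluctuation logarithm `log ∫ e^{V h U} dν_{h,U}` sandwiched by `logFl_le` / `le_logFl`.
[cite: Balaban1985UV3, (22) p.261, (26) p.263, (58) p.270] -/
theorem FluctuationModel.logFluct_eq_of_cov (hν : ∀ h U, (M.ν h U).map e = M.ν h (τ U))
    (hV : ∀ h U A, M.V h (τ U) (e A) = M.V h U A) (h : T.Hist (k + 1)) (U : T.Cfg (k + 1)) :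
    Real.log (∫ ω, Real.exp (M.V h (τ U) ω) ∂(M.ν h (τ U))) =
      Real.log (∫ ω, Real.exp (M.V h U ω) ∂(M.ν h U)) :=
  log_integral_exp_eq_of_cov (hν h) (hV h) U

/-- … and the small-field mass of `SmallFieldVolume`. [folklore] -/
theorem FluctuationModel.mass_eq_of_cov (hν : ∀ h U, (M.ν h U).map e = M.ν h (τ U)) (h : T.Hist (k + 1))
    (U : T.Cfg (k + 1)) : (M.ν h (τ U)).real Set.univ = (M.ν h U).real Set.univ :=
  measureReal_univ_eq_of_cov (hν h) U

end Step

/-! ## §3. *"all the expansions and expressions introduced later preserve this property"*: localisation of vertices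
## by a background-independent decomposition of unity; joint cumulants; the walk-deformed generating family -/

section Expansions

variable {𝔘 Ω : Type*} {Λ 𝔅 : Type*} [Fintype Λ]

/-- A vertex `Σ_x v U x A` LOCALIZED by partition weights `h □ x` (*"We localize vertices in big blocks by a
decomposition of unity"*): `locVertex h v U □ A = Σ_x h □ x · v U x A`.  The weights do not depend on the background.
[cite: Balaban1985UV3, p.262 (second paragraph)] -/
def locVertex (h : 𝔅 → Λ → ℝ) (v : 𝔘 → Λ → Ω → ℝ) (U : 𝔘) (q : 𝔅) (A : Ω) : ℝ := ∑ x, h q x * v U x A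

/-- A sitewise jointly invariant vertex density stays jointly invariant after localisation, block by block (the
weights are background-independent numbers). [cite: Balaban1985UV3, p.262 + (26) p.263 («all the expansions and expressions introduced later preserve this property»)] -/
theorem locVertex_jointInvariant {h : 𝔅 → Λ → ℝ} {v : 𝔘 → Λ → Ω → ℝ} {τ : 𝔘 → 𝔘} {e : Ω → Ω}
    (hv : ∀ U x A, v (τ U) x (e A) = v U x A) (U : 𝔘) (q : 𝔅) (A : Ω) :
    locVertex h v (τ U) q (e A) = locVertex h v U q A := by
  simp only [locVertex, hv]

/-- The localized vertices resum to the vertex when the weights are a decomposition of unity. [folklore] -/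
theorem sum_locVertex [Fintype 𝔅] {h : 𝔅 → Λ → ℝ} (h1 : ∀ x, ∑ q, h q x = 1) (v : 𝔘 → Λ → Ω → ℝ) (U : 𝔘)
    (A : Ω) : ∑ q, locVertex h v U q A = ∑ x, v U x A := by
  simp only [locVertex]
  rw [Finset.sum_comm]
  simp only [← Finset.sum_mul, h1, one_mul]

variable [MeasurableSpace Ω] {κ : Type*} [Fintype κ]

/-- The JOINT cumulant generating function `t ↦ log ∫ exp(Σᵢ tᵢ Vᵢ) dν` of a finite family of vertices — the
generating function of the *"connected vacuum graphs with vertices"* `V₁, …, Vₙ`. [folklore] -/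
noncomputable def jointCgf (V : κ → Ω → ℝ) (ν : Measure Ω) (t : κ → ℝ) : ℝ :=
  Real.log (∫ ω, Real.exp (∑ i, t i * V i ω) ∂ν)

/-- `jointCgf` is the sibling's one-variable `cgf` of the linear combination `Σᵢ tᵢVᵢ` at `1`. [folklore] -/
theorem jointCgf_eq_cgf (V : κ → Ω → ℝ) (ν : Measure Ω) (t : κ → ℝ) :
    jointCgf V ν t = cgf (fun ω => ∑ i, t i * V i ω) ν 1 := by
  simp [jointCgf, cgf, mgf]

/-- … and for a one-member family it IS `cgf`. [folklore] -/
theorem jointCgf_unique (V : Ω → ℝ) (ν : Measure Ω) (t : ℝ) :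
    jointCgf (fun _ : Unit => V) ν (fun _ => t) = cgf V ν t := by
  simp [jointCgf, cgf, mgf]

/-- The `n`-th JOINT CUMULANT `⟨V₁; …; Vₙ⟩ᵀ = ∂ⁿ/∂t₁⋯∂tₙ|_{t=0} log ∫ exp(Σ tᵢVᵢ) dν` — one *"lower order connected
vacuum graph"* sum with prescribed vertices, DEFINED as the mixed Taylor coefficient (the identification with a sum
over connected graphs is Wick's theorem, not used here). [folklore] -/
noncomputable def jointCumulant {n : ℕ} (V : Fin n → Ω → ℝ) (ν : Measure Ω) : ℝ :=
  iteratedFDeriv ℝ n (jointCgf V ν) 0 (fun i => Pi.single i 1)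

/-- Under a covariant family of measures a jointly invariant family of vertices has an invariant joint cumulant
generating function AS A FUNCTION of `t`. [cite: Balaban1985UV3, p.262 + (26) p.263] -/
theorem jointCgf_eq_of_cov {ν : 𝔘 → Measure Ω} {τ : 𝔘 → 𝔘} {e : Ω ≃ᵐ Ω}
    (hν : ∀ U, (ν U).map e = ν (τ U)) {W : 𝔘 → κ → Ω → ℝ} (hW : ∀ U i A, W (τ U) i (e A) = W U i A)
    (U : 𝔘) : jointCgf (W (τ U)) (ν (τ U)) = jointCgf (W U) (ν U) := by
  funext t
  simp only [jointCgf]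
  rw [← hν U, integral_map_equiv]
  simp only [hW]

/-- … hence every joint cumulant (every connected-graph sum with prescribed, e.g. localized, vertices) is invariant.
[cite: Balaban1985UV3, p.262 + (26) p.263] -/
theorem jointCumulant_eq_of_cov {ν : 𝔘 → Measure Ω} {τ : 𝔘 → 𝔘} {e : Ω ≃ᵐ Ω}
    (hν : ∀ U, (ν U).map e = ν (τ U)) {n : ℕ} {W : 𝔘 → Fin n → Ω → ℝ}
    (hW : ∀ U i A, W (τ U) i (e A) = W U i A) (U : 𝔘) :
    jointCumulant (W (τ U)) (ν (τ U)) = jointCumulant (W U) (ν U) := by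
  simp only [jointCumulant, jointCgf_eq_of_cov hν hW U]

/-- THE WALK-DEFORMED GENERATING FAMILY: measures `ν U s` depending on deformation parameters `s` (one per random walk
of (3.107), weighting the walk's term in the expanded covariance) and covariant FOR EVERY `s`, with jointly invariant
vertices, have a generating family `(t, s) ↦ log ∫ exp(Σ tᵢ Wᵢ) dν_{U,s}` invariant AS A FUNCTION of `(t, s)`.
[cite: Balaban1985UV3, p.262 («we expand the propagators C⁽⁰⁾(Ω₁, U₁) into the generalized random walk expansion») + (26) p.263; Balaban1985BackgroundPropagators, (3.107) p.416, (3.34) p.396] -/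
theorem jointCgf_deformed_eq_of_cov {σ : Type*} {ν : 𝔘 → σ → Measure Ω} {τ : 𝔘 → 𝔘} {e : Ω ≃ᵐ Ω}
    (hν : ∀ U s, (ν U s).map e = ν (τ U) s) {W : 𝔘 → κ → Ω → ℝ}
    (hW : ∀ U i A, W (τ U) i (e A) = W U i A) (U : 𝔘) :
    (fun p : (κ → ℝ) × σ => jointCgf (W (τ U)) (ν (τ U) p.2) p.1) =
      fun p => jointCgf (W U) (ν U p.2) p.1 := by
  funext p
  exact congrFun (jointCgf_eq_of_cov (ν := fun U => ν U p.2) (fun U => hν U p.2) hW U) p.1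

/-- … hence EVERY FUNCTIONAL `Φ` of the deformed generating family is invariant — every mixed Taylor coefficient in
`(t, s)` (a graph whose lines carry prescribed walks: one *"expression"* of p. 262 under the [folklore] Wick /
multilinearity dictionary) and every finite sum of them (*"Summing the expressions with the same localization X"*):
(26) for the pieces `𝒫′₁(g₀, X, ·)`, GIVEN the dictionary. [cite: Balaban1985UV3, p.262, (24), (26) p.263] -/
theorem functional_deformed_eq_of_cov {σ β : Type*} {ν : 𝔘 → σ → Measure Ω} {τ : 𝔘 → 𝔘} {e : Ω ≃ᵐ Ω}
    (hν : ∀ U s, (ν U s).map e = ν (τ U) s) {W : 𝔘 → κ → Ω → ℝ}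
    (hW : ∀ U i A, W (τ U) i (e A) = W U i A) (Φ : ((κ → ℝ) × σ → ℝ) → β) (U : 𝔘) :
    Φ (fun p => jointCgf (W (τ U)) (ν (τ U) p.2) p.1) = Φ (fun p => jointCgf (W U) (ν U p.2) p.1) :=
  congrArg Φ (jointCgf_deformed_eq_of_cov hν hW U)

end Expansions

/-! ## §4. [folklore] The fibred Euclidean model: `dA` = Lebesgue measure on `B → F`, `R(𝓊)` = a bondwise linear
## isometry; `dA`, `χ` and the Gaussian density ARE invariant, so (26) for the (22)-shaped integral needs no
## hypothesis on the measure -/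

section Fibred

variable {𝔘 : Type*} {B : Type*} [Fintype B] {F : Type*} [NormedAddCommGroup F] [InnerProductSpace ℝ F]
  [MeasurableSpace F] [BorelSpace F]

/-- `R(𝓊)` on fields `A : B → F`: the bondwise linear isometry `(rot L A) b = L b (A b)` as a measurable equivalence
(print: R(𝓊) acts on `A(b) ∈ 𝔤` through the adjoint action at the initial point of `b`, an orthogonal map for the
Killing form). [cite: Balaban1985UV3, (26) p.263; Balaban1985BackgroundPropagators, (3.28) p.395] -/
def rot (L : B → (F ≃ₗᵢ[ℝ] F)) : (B → F) ≃ᵐ (B → F) where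
  toFun A b := L b (A b)
  invFun A b := (L b).symm (A b)
  left_inv A := funext fun b => (L b).symm_apply_apply (A b)
  right_inv A := funext fun b => (L b).apply_symm_apply (A b)
  measurable_toFun := measurable_pi_iff.2 fun b => (L b).continuous.measurable.comp (measurable_pi_apply b)
  measurable_invFun :=
    measurable_pi_iff.2 fun b => (L b).symm.continuous.measurable.comp (measurable_pi_apply b)

omit [Fintype B] in
/-- Evaluation of `rot`. [folklore] -/
@[simp] theorem rot_apply (L : B → (F ≃ₗᵢ[ℝ] F)) (A : B → F) (b : B) : rot L A b = L b (A b) := rfl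

/-- *"The measure dA is invariant with respect to the orthogonal transformations A → R(𝓊)A"* — a THEOREM for Lebesgue
measure on `B → F` and every bondwise linear isometry. [cite: Balaban1985UV3, (26) p.263 (last sentence of the paragraph)] -/
theorem measurePreserving_rot [FiniteDimensional ℝ F] (L : B → (F ≃ₗᵢ[ℝ] F)) :
    MeasurePreserving (rot L) (volume : Measure (B → F)) volume :=
  volume_preserving_pi fun b => (L b).measurePreserving

omit [Fintype B] in
/-- Mathlib's standard Gaussian measure on a finite-dimensional inner-product space is preserved by every linear
isometry (the reference-Gaussian reading of *"dμ is a Gaussian measure"*). [folklore] -/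
theorem measurePreserving_stdGaussian {E : Type*} [NormedAddCommGroup E] [InnerProductSpace ℝ E]
    [FiniteDimensional ℝ E] [MeasurableSpace E] [BorelSpace E] (L : E ≃ₗᵢ[ℝ] E) :
    MeasurePreserving L (stdGaussian E) (stdGaussian E) :=
  ⟨L.continuous.measurable, stdGaussian_map L⟩

open Classical in
/-- The small-field characteristic function `χ = Π_{b∈Ω₁} χ({|A(b)| < p})` of (22).
[cite: Balaban1985UV3, (22) p.261] -/
noncomputable def chiSmall (p : ℝ) (A : B → F) : ℝ := ∏ b, if ‖A b‖ < p then 1 else 0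

/-- `χ` is `R(𝓊)`-invariant (isometries preserve `|A(b)|`). [cite: Balaban1985UV3, (22) p.261, (26) p.263] -/
theorem chiSmall_rot (p : ℝ) (L : B → (F ≃ₗᵢ[ℝ] F)) (A : B → F) : chiSmall p (rot L A) = chiSmall p A := by
  simp only [chiSmall, rot_apply, LinearIsometryEquiv.norm_map]

/-- The quadratic form `⟨A, Δ(U)A⟩ = Σ_b ⟪A(b), (Δ(U)A)(b)⟫` of the Gaussian in (22). [cite: Balaban1985UV3, (22) p.261] -/
def quadForm (Δ : 𝔘 → (B → F) → (B → F)) (U : 𝔘) (A : B → F) : ℝ := ∑ b, ⟪A b, Δ U A b⟫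

/-- *"⟨R(u)A, Δ^η(Uᵘ)R(u)A⟩ = ⟨A, Δ^η(U)A⟩"* from the intertwining law `Δ(Uᵘ)R(u) = R(u)Δ(U)` ((3.30), (3.34) in
the form typed by `B9Eq333Cov`) and orthogonality of `R(u)`.
[cite: Balaban1985BackgroundPropagators, (3.30) p.395, (3.34) p.396] -/
theorem quadForm_jointInvariant {Δ : 𝔘 → (B → F) → (B → F)} {τ : 𝔘 → 𝔘} {L : B → (F ≃ₗᵢ[ℝ] F)}
    (hΔ : ∀ U A, Δ (τ U) (rot L A) = rot L (Δ U A)) (U : 𝔘) (A : B → F) :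
    quadForm Δ (τ U) (rot L A) = quadForm Δ U A := by
  simp only [quadForm, hΔ, rot_apply, LinearIsometryEquiv.inner_map_map]

/-- The (22)-shaped integrand `exp(−½⟨A, Δ(U)A⟩)·χ(A)·exp(V(U, A))` against `dA`.
[cite: Balaban1985UV3, (22) p.261] -/
noncomputable def fluctIntegrand (Δ : 𝔘 → (B → F) → (B → F)) (p : ℝ) (V : 𝔘 → (B → F) → ℝ) (U : 𝔘)
    (A : B → F) : ℝ :=
  Real.exp (-(quadForm Δ U A) / 2) * chiSmall p A * Real.exp (V U A)

/-- *"the invariance of the expressions …, if we make the simultaneous transformations U₁ → U₁ᵘ, A′ → R(𝓊)A′"* for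
the (22)-shaped integrand: Gaussian part by (3.30), `χ` by isometry, potential by hypothesis.
[cite: Balaban1985UV3, (22) p.261, (26) p.263; Balaban1985BackgroundPropagators, (3.30) p.395] -/
theorem fluctIntegrand_jointInvariant {Δ : 𝔘 → (B → F) → (B → F)} {τ : 𝔘 → 𝔘} {L : B → (F ≃ₗᵢ[ℝ] F)}
    (hΔ : ∀ U A, Δ (τ U) (rot L A) = rot L (Δ U A)) {p : ℝ} {V : 𝔘 → (B → F) → ℝ}
    (hV : ∀ U A, V (τ U) (rot L A) = V U A) (U : 𝔘) (A : B → F) :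
    fluctIntegrand Δ p V (τ U) (rot L A) = fluctIntegrand Δ p V U A := by
  simp only [fluctIntegrand, quadForm_jointInvariant hΔ, chiSmall_rot, hV]

/-- **(26) FOR THE (22)-SHAPED FLUCTUATION INTEGRAL IN THE EUCLIDEAN MODEL, with NO hypothesis on the measure**:
`∫ exp(−½⟨A,Δ(Uᵘ)A⟩)χ(A)exp(V(Uᵘ,A)) dA = ∫ exp(−½⟨A,Δ(U)A⟩)χ(A)exp(V(U,A)) dA` from the intertwining law for `Δ`
and joint invariance of `V` alone — §1's sentence with (H1) a theorem.
[cite: Balaban1985UV3, (22) p.261, (26) p.263; Balaban1985BackgroundPropagators, (3.30) p.395] -/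
theorem integral_fluctIntegrand_eq [FiniteDimensional ℝ F] {Δ : 𝔘 → (B → F) → (B → F)} {τ : 𝔘 → 𝔘}
    {L : B → (F ≃ₗᵢ[ℝ] F)} (hΔ : ∀ U A, Δ (τ U) (rot L A) = rot L (Δ U A)) {p : ℝ} {V : 𝔘 → (B → F) → ℝ}
    (hV : ∀ U A, V (τ U) (rot L A) = V U A) (U : 𝔘) :
    ∫ A, fluctIntegrand Δ p V (τ U) A = ∫ A, fluctIntegrand Δ p V U A :=
  integral_eq_of_jointInvariant (measurePreserving_rot L) (fluctIntegrand_jointInvariant hΔ hV) U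

/-- The Gaussian DENSITY MEASURE `exp(−½⟨A, Δ(U)A⟩)·dA` (un-normalised `dμ_{C⁽⁰⁾(Ω₁,U₁)}` up to the gauge-fixing
factor) is a covariant family. [cite: Balaban1985UV3, (22) p.261; Balaban1985BackgroundPropagators, (3.30) p.395] -/
theorem cov_gaussDensity [FiniteDimensional ℝ F] {Δ : 𝔘 → (B → F) → (B → F)} {τ : 𝔘 → 𝔘}
    {L : B → (F ≃ₗᵢ[ℝ] F)} (hΔ : ∀ U A, Δ (τ U) (rot L A) = rot L (Δ U A)) (U : 𝔘) :
    ((volume : Measure (B → F)).withDensity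
        (fun A => ENNReal.ofReal (Real.exp (-(quadForm Δ U A) / 2)))).map (rot L) =
      (volume : Measure (B → F)).withDensity
        (fun A => ENNReal.ofReal (Real.exp (-(quadForm Δ (τ U) A) / 2))) :=
  cov_withDensity_of_jointInvariant (measurePreserving_rot L)
    (w := fun U A => ENNReal.ofReal (Real.exp (-(quadForm Δ U A) / 2)))
    (fun U A => by simp only [quadForm_jointInvariant hΔ]) U

/-- … and so is its `χ`-weighting `χ·exp(−½⟨A, Δ(U)A⟩)·dA` — the (un-normalised) measure `dμ_{C⁽⁰⁾}(A)χ` of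
`∫μχ exp V`, i.e. hypothesis (H3) of §1–§3 DISCHARGED in the model.
[cite: Balaban1985UV3, (22) p.261, (26) p.263] -/
theorem cov_gaussChi [FiniteDimensional ℝ F] {Δ : 𝔘 → (B → F) → (B → F)} {τ : 𝔘 → 𝔘}
    {L : B → (F ≃ₗᵢ[ℝ] F)} (hΔ : ∀ U A, Δ (τ U) (rot L A) = rot L (Δ U A)) (p : ℝ) (U : 𝔘) :
    (chiMeasure ((volume : Measure (B → F)).withDensity
        (fun A => ENNReal.ofReal (Real.exp (-(quadForm Δ U A) / 2)))) (chiSmall p)).map (rot L) =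
      chiMeasure ((volume : Measure (B → F)).withDensity
        (fun A => ENNReal.ofReal (Real.exp (-(quadForm Δ (τ U) A) / 2)))) (chiSmall p) :=
  cov_chiMeasure (ν := fun U => (volume : Measure (B → F)).withDensity
      (fun A => ENNReal.ofReal (Real.exp (-(quadForm Δ U A) / 2))))
    (cov_gaussDensity hΔ) (χ := fun _ => chiSmall p) (fun _ A => chiSmall_rot p L A) U

end Fibred

/-! ## §5. The JOIN with the lineage: a measure-defined localized family has the class-function binder `hcls` of
## `B10Eq31GlobalConj` / `B10Eq32SuN` once its measure is covariant and its integrand jointly invariant -/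

section Join

variable {D : LocDomainSys} {ι : Type*} {𝔸 : Type*} [CStarAlgebra 𝔸] {Ω : Type*} [MeasurableSpace Ω]

/-- A MEASURE-DEFINED localized family: `measE ν F X V = ∫ F X V A dν_V(A)` — the shape of every printed piece
(`𝒫′₁(g₀, X, U₁)` is a sum of integrals of localized expressions against the fluctuation measure at background `U₁`).
[cite: Balaban1985UV3, (22) p.261, (24) p.262] -/
noncomputable def measE (ν : (ι → 𝔸) → Measure Ω) (F : D.Dom → (ι → 𝔸) → Ω → ℂ) (X : D.Dom) (V : ι → 𝔸) : ℂ :=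
  ∫ A, F X V A ∂(ν V)

/-- **(J-0) = (26) LITERALLY, for the constant gauge transformations**: if the fluctuation measure is covariant and the
localized integrand jointly invariant under `(V, A) ↦ ((W·V_b·W⋆)_b, e_W A)` for UNITARY-valued configurations `V`
and unitary `W`, then `measE ν F X (W·V·W⋆) = measE ν F X V` there.
[cite: Balaban1985UV3, (26) p.263 + the three sentences after it] -/
theorem unitaryClassFn_measE_of_cov {ν : (ι → 𝔸) → Measure Ω} {F : D.Dom → (ι → 𝔸) → Ω → ℂ}
    {e : unitary 𝔸 → Ω ≃ᵐ Ω}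
    (hν : ∀ W : unitary 𝔸, ∀ V : ι → 𝔸, (∀ b, V b ∈ unitary 𝔸) →
      (ν V).map (e W) = ν (fun b => (W : 𝔸) * V b * star (W : 𝔸)))
    (hF : ∀ X, ∀ W : unitary 𝔸, ∀ V : ι → 𝔸, (∀ b, V b ∈ unitary 𝔸) →
      ∀ A, F X (fun b => (W : 𝔸) * V b * star (W : 𝔸)) (e W A) = F X V A) :
    ∀ X, ∀ W ∈ unitary 𝔸, ∀ V : ι → 𝔸, (∀ b, V b ∈ unitary 𝔸) →
      measE ν F X (fun b => W * V b * star W) = measE ν F X V := by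
  intro X W hW V hV
  simp only [measE]
  rw [← hν ⟨W, hW⟩ V hV, integral_map_equiv]
  simp only [hF X ⟨W, hW⟩ V hV]

/-- **(J-a) THE LINEAGE'S BINDER `hcls`, DISCHARGED**: covariance of the measure and joint invariance of the integrand
on the complex tube `TubeCfg ι 𝔸 a` (preserved by the conjugations, `conj_mem_tubeCfg`) give
`∀ X, ∀ W ∈ unitary 𝔸, ∀ V ∈ TubeCfg ι 𝔸 a, measE ν F X (W·V·W⋆) = measE ν F X V` verbatim.
[cite: Balaban1985UV3, (26) p.263; Balaban1987RG1, p.283] -/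
theorem classFn_measE_of_cov {a : ℝ} {ν : (ι → 𝔸) → Measure Ω} {F : D.Dom → (ι → 𝔸) → Ω → ℂ}
    {e : unitary 𝔸 → Ω ≃ᵐ Ω}
    (hν : ∀ W : unitary 𝔸, ∀ V ∈ TubeCfg ι 𝔸 a,
      (ν V).map (e W) = ν (fun b => (W : 𝔸) * V b * star (W : 𝔸)))
    (hF : ∀ X, ∀ W : unitary 𝔸, ∀ V ∈ TubeCfg ι 𝔸 a,
      ∀ A, F X (fun b => (W : 𝔸) * V b * star (W : 𝔸)) (e W A) = F X V A) :
    ∀ X, ∀ W ∈ unitary 𝔸, ∀ V ∈ TubeCfg ι 𝔸 a,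
      measE ν F X (fun b => W * V b * star W) = measE ν F X V := by
  intro X W hW V hV
  simp only [measE]
  rw [← hν ⟨W, hW⟩ V hV, integral_map_equiv]
  simp only [hF X ⟨W, hW⟩ V hV]

/-- HYPOTHESIS SHAPE (H6), an IDENTITY PRINCIPLE along the unitary slice: two functions holomorphic on the bondwise
tube which agree on the unitary-valued configurations agree on the tube (the unitaries are a totally real slice of
maximal dimension; [folklore], not proved here) — the located *"extended analytically"* step by which (26), printed for
`G`-valued configurations, is read on the complex spaces. [cite: Balaban1987RG1, p.283; Balaban1985UV3, p.263 («The third property is the analyticity with respect to U₁»)] -/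
def TubeIdentity (ι 𝔸 : Type*) [CStarAlgebra 𝔸] (a : ℝ) : Prop :=
  ∀ φ ψ : (ι → 𝔸) → ℂ, DifferentiableOn ℂ φ (TubeCfg ι 𝔸 a) → DifferentiableOn ℂ ψ (TubeCfg ι 𝔸 a) →
    (∀ V : ι → 𝔸, (∀ b, V b ∈ unitary 𝔸) → φ V = ψ V) → ∀ V ∈ TubeCfg ι 𝔸 a, φ V = ψ V

/-- Unitary-valued configurations lie in every bondwise tube of positive half-width (`V_b = exp(0)·V_b`). [folklore] -/
theorem mem_tubeCfg_of_forall_unitary {a : ℝ} (ha : 0 < a) {V : ι → 𝔸} (hV : ∀ b, V b ∈ unitary 𝔸) :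
    V ∈ TubeCfg ι 𝔸 a :=
  fun b => ⟨0, V b, by simpa using ha, hV b, by simp⟩

/-- The bondwise conjugation `V ↦ (W·V_b·W′)_b` is (complex-)differentiable. [folklore] -/
theorem differentiable_conj (W W' : 𝔸) : Differentiable ℂ fun V : ι → 𝔸 => fun b => W * V b * W' :=
  (B10Eq31GlobalConj.conjCfg (ι := ι) W W').differentiable

variable [Fintype ι]

/-- **(J-b)** (26) on the UNITARY-valued configurations + holomorphy of each `E X` on the tube (*"The third property
is the analyticity with respect to U₁"*) + the identity principle (H6) give the lineage's binder `hcls` on the tube.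
[cite: Balaban1985UV3, (26) p.263 + p.263 («third property»); Balaban1987RG1, p.283] -/
theorem classFn_of_unitaryClassFn {a : ℝ} (hId : TubeIdentity ι 𝔸 a) {E : D.Dom → (ι → 𝔸) → ℂ}
    (hEan : ∀ X, DifferentiableOn ℂ (E X) (TubeCfg ι 𝔸 a))
    (h26 : ∀ X, ∀ W ∈ unitary 𝔸, ∀ V : ι → 𝔸, (∀ b, V b ∈ unitary 𝔸) →
      E X (fun b => W * V b * star W) = E X V) :
    ∀ X, ∀ W ∈ unitary 𝔸, ∀ V ∈ TubeCfg ι 𝔸 a, E X (fun b => W * V b * star W) = E X V := by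
  intro X W hW
  refine hId (fun V => E X (fun b => W * V b * star W)) (E X) ?_ (hEan X) ?_
  · exact (hEan X).comp (differentiable_conj W (star W)).differentiableOn
      fun V hV => conj_mem_tubeCfg hV hW
  · intro V hV
    exact h26 X W hW V hV

/-- **(J-0) + (J-b)**: a measure-defined family covariant / jointly invariant on unitary-valued configurations,
holomorphic on the tube, with (H6): `hcls`. [cite: Balaban1985UV3, (26) p.263; Balaban1987RG1, p.283] -/
theorem classFn_measE_of_unitaryCov {a : ℝ} (hId : TubeIdentity ι 𝔸 a) {ν : (ι → 𝔸) → Measure Ω}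
    {F : D.Dom → (ι → 𝔸) → Ω → ℂ} {e : unitary 𝔸 → Ω ≃ᵐ Ω}
    (hEan : ∀ X, DifferentiableOn ℂ (measE ν F X) (TubeCfg ι 𝔸 a))
    (hν : ∀ W : unitary 𝔸, ∀ V : ι → 𝔸, (∀ b, V b ∈ unitary 𝔸) →
      (ν V).map (e W) = ν (fun b => (W : 𝔸) * V b * star (W : 𝔸)))
    (hF : ∀ X, ∀ W : unitary 𝔸, ∀ V : ι → 𝔸, (∀ b, V b ∈ unitary 𝔸) →
      ∀ A, F X (fun b => (W : 𝔸) * V b * star (W : 𝔸)) (e W A) = F X V A) :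
    ∀ X, ∀ W ∈ unitary 𝔸, ∀ V ∈ TubeCfg ι 𝔸 a,
      measE ν F X (fun b => W * V b * star W) = measE ν F X V :=
  classFn_of_unitaryClassFn hId hEan (unitaryClassFn_measE_of_cov hν hF)

variable {sp' sp : D.Dom → Set (ι → 𝔸)} {gen : D.Dom → (ι → 𝔸) → ι → 𝔸} {nX : D.Dom → ℕ}

/-- **THE LINEAGE'S JOINT THEOREM WITH `hcls` DISCHARGED FROM THE PRINTED MECHANISM** — `B10Eq31GlobalConj.
logHalfBound_expLine_cplx_of_classFn` for a measure-defined family `E = measE ν F`, its class-function binder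
replaced by covariance of `ν` and joint invariance of `F` on the tube (J-a); all other binders unchanged.  Constant
`8·((2p + q)/(min(1/8, a/2) − p))²·B`, rate `r − 2`.
[cite: Balaban1985UV3, (26) p.263 (+ mechanism), (29) p.263, (31)–(32) p.264, (61) p.271; Balaban1987RG1, (1.13) p.262, p.283] -/
theorem logHalfBound_expLine_cplx_of_cov {B r a p q : ℝ} (hp : 0 ≤ p) (hq : 0 ≤ q) (hpq : 0 < p + q)
    (hpa : p < min (1 / 8) (a / 2)) (hB : 0 ≤ B) {ν : (ι → 𝔸) → Measure Ω} {F : D.Dom → (ι → 𝔸) → Ω → ℂ}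
    {e : unitary 𝔸 → Ω ≃ᵐ Ω}
    (hsplit : ∀ X φ, φ ∈ sp' X → ∀ b, ∃ S ∈ skewAdjoint 𝔸,
      ‖S‖ ≤ q * (1 + D.dj X) ∧ ‖gen X φ b - S‖ ≤ p)
    (hsp : ∀ X, TubeCfg ι 𝔸 a ⊆ sp X) (hE : ∀ X, DifferentiableOn ℂ (measE ν F X) (sp X))
    (hν : ∀ W : unitary 𝔸, ∀ V ∈ TubeCfg ι 𝔸 a,
      (ν V).map (e W) = ν (fun b => (W : 𝔸) * V b * star (W : 𝔸)))
    (hF : ∀ X, ∀ W : unitary 𝔸, ∀ V ∈ TubeCfg ι 𝔸 a,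
      ∀ A, F X (fun b => (W : 𝔸) * V b * star (W : 𝔸)) (e W A) = F X V A)
    (hcomm : ∀ X φ, φ ∈ sp' X → ∀ b, gen X φ b ∈ closure (commSpan 𝔸 : Set 𝔸))
    (hEb : B13.LogHalfBound D sp (measE ν F) nX B r) :
    B13.LogHalfBound D sp' (diffAlongV (measE ν F) (expLine gen (fun _ _ _ => 1))) nX
      (8 * ((2 * p + q) / (min (1 / 8) (a / 2) - p)) ^ 2 * B) (r - 2) :=
  logHalfBound_expLine_cplx_of_classFn hp hq hpq hpa hB hsplit hsp hE (classFn_measE_of_cov hν hF) hcomm hEb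

end Join

/-! ### §5b. The `SU(N)` form (`B10Eq32SuN`): covariance under the special unitaries, traceless generators -/

section JoinSuN

open scoped Matrix.Norms.L2Operator

variable (N : ℕ) {D : LocDomainSys} {ι : Type*} [Fintype ι] {Ω : Type*} [MeasurableSpace Ω]
  {sp' sp : D.Dom → Set (ι → Matrix (Fin N) (Fin N) ℂ)}
  {gen : D.Dom → (ι → Matrix (Fin N) (Fin N) ℂ) → ι → Matrix (Fin N) (Fin N) ℂ} {nX : D.Dom → ℕ}

/-- **`SU(N)` FORM**: for `𝔸 = M_N(ℂ)`, covariance of `ν` and joint invariance of `F` under the conjugations by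
`W ∈ SU(N)` only — (26) for the constant gauge transformations with values in `G = SU(N)` — and traceless bond
generators give the lineage's `B13.LogHalfBound` for the differenced family (`classFn_of_suClassFn`,
`mem_closure_commSpan_of_trace_eq_zero`).  Constant `8·((2p + q)/(min(1/8, a/2) − p))²·B`, rate `r − 2`.
[cite: Balaban1985UV3, (26)–(27), (29) p.263, (31)–(32) p.264, (61) p.271; Balaban1987RG1, (1.13) p.262, p.283] -/
theorem logHalfBound_expLine_cplx_of_suCov {B r a p q : ℝ} (hp : 0 ≤ p) (hq : 0 ≤ q) (hpq : 0 < p + q)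
    (hpa : p < min (1 / 8) (a / 2)) (hB : 0 ≤ B) {ν : (ι → Matrix (Fin N) (Fin N) ℂ) → Measure Ω}
    {F : D.Dom → (ι → Matrix (Fin N) (Fin N) ℂ) → Ω → ℂ}
    {e : Matrix.specialUnitaryGroup (Fin N) ℂ → Ω ≃ᵐ Ω} :
    letI := cstarAlgebraMatrix N
    ∀ (_hsplit : ∀ X φ, φ ∈ sp' X → ∀ b, ∃ S ∈ skewAdjoint (Matrix (Fin N) (Fin N) ℂ),
        ‖S‖ ≤ q * (1 + D.dj X) ∧ ‖gen X φ b - S‖ ≤ p)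
      (_hsp : ∀ X, TubeCfg ι (Matrix (Fin N) (Fin N) ℂ) a ⊆ sp X)
      (_hE : ∀ X, DifferentiableOn ℂ (measE ν F X) (sp X))
      (_hν : ∀ W : Matrix.specialUnitaryGroup (Fin N) ℂ, ∀ V ∈ TubeCfg ι (Matrix (Fin N) (Fin N) ℂ) a,
        (ν V).map (e W) = ν (fun b => (W : Matrix (Fin N) (Fin N) ℂ) * V b * star (W : Matrix (Fin N) (Fin N) ℂ)))
      (_hF : ∀ X, ∀ W : Matrix.specialUnitaryGroup (Fin N) ℂ, ∀ V ∈ TubeCfg ι (Matrix (Fin N) (Fin N) ℂ) a,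
        ∀ A, F X (fun b => (W : Matrix (Fin N) (Fin N) ℂ) * V b * star (W : Matrix (Fin N) (Fin N) ℂ)) (e W A) =
          F X V A)
      (_htr : ∀ X φ, φ ∈ sp' X → ∀ b, Matrix.trace (gen X φ b) = 0)
      (_hEb : B13.LogHalfBound D sp (measE ν F) nX B r),
    B13.LogHalfBound D sp' (diffAlongV (measE ν F) (expLine gen (fun _ _ _ => 1))) nX
      (8 * ((2 * p + q) / (min (1 / 8) (a / 2) - p)) ^ 2 * B) (r - 2) := by
  letI := cstarAlgebraMatrix N
  intro hsplit hsp hE hν hF htr hEb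
  have hsu : ∀ X, ∀ W ∈ Matrix.specialUnitaryGroup (Fin N) ℂ, ∀ V ∈ TubeCfg ι (Matrix (Fin N) (Fin N) ℂ) a,
      measE ν F X (fun b => W * V b * star W) = measE ν F X V := by
    intro X W hW V hV
    simp only [measE]
    rw [← hν ⟨W, hW⟩ V hV, integral_map_equiv]
    simp only [hF X ⟨W, hW⟩ V hV]
  exact logHalfBound_expLine_cplx_of_classFn hp hq hpq hpa hB hsplit hsp hE (fun X => classFn_of_suClassFn (hsu X))
    (mem_closure_commSpan_of_trace_eq_zero N htr) hEb

end JoinSuN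

/-! ## §6. Non-vacuity -/

section Toys

/-- (T1) §1's sentence with BOTH inputs proved, on any finite-dimensional Euclidean space: the weight
`exp(−‖A‖²)·cos⟪n, A⟫` with background `n` is jointly invariant under `(n, A) ↦ (Ln, LA)` for a linear isometry `L`
and Lebesgue measure is `L`-invariant, so `∫ exp(−‖A‖²)cos⟪Ln, A⟫ dA = ∫ exp(−‖A‖²)cos⟪n, A⟫ dA` — a rotated
background gives the same integral. [folklore] -/
theorem example_integral_rot {E : Type*} [NormedAddCommGroup E] [InnerProductSpace ℝ E] [FiniteDimensional ℝ E]
    [MeasurableSpace E] [BorelSpace E] (L : E ≃ₗᵢ[ℝ] E) (n : E) :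
    ∫ A, Real.exp (-‖A‖ ^ 2) * Real.cos ⟪L n, A⟫ = ∫ A, Real.exp (-‖A‖ ^ 2) * Real.cos ⟪n, A⟫ :=
  integral_eq_of_jointInvariant (τ := fun n => L n) (e := L.toMeasurableEquiv) L.measurePreserving
    (ρ := fun n A => Real.exp (-‖A‖ ^ 2) * Real.cos ⟪n, A⟫)
    (fun n A => by simp [LinearIsometryEquiv.inner_map_map]) n

variable {𝔸 : Type*} [CStarAlgebra 𝔸] [MeasurableSpace 𝔸] [BorelSpace 𝔸]

/-- (T2, data) Conjugation by a unitary as a measurable equivalence of `𝔸` (fields `A` with values in `𝔸` itself).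
[folklore] -/
noncomputable def conjEquiv (W : unitary 𝔸) : 𝔸 ≃ᵐ 𝔸 where
  toFun A := (W : 𝔸) * A * star (W : 𝔸)
  invFun A := star (W : 𝔸) * A * (W : 𝔸)
  left_inv A := by
    calc star (W : 𝔸) * ((W : 𝔸) * A * star (W : 𝔸)) * (W : 𝔸)
        = star (W : 𝔸) * (W : 𝔸) * A * (star (W : 𝔸) * (W : 𝔸)) := by noncomm_ring
      _ = A := by rw [Unitary.star_mul_self_of_mem W.2, one_mul, mul_one]
  right_inv A := by
    calc (W : 𝔸) * (star (W : 𝔸) * A * (W : 𝔸)) * star (W : 𝔸)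
        = (W : 𝔸) * star (W : 𝔸) * A * ((W : 𝔸) * star (W : 𝔸)) := by noncomm_ring
      _ = A := by rw [Unitary.mul_star_self_of_mem W.2, one_mul, mul_one]
  measurable_toFun := ((continuous_const.mul continuous_id).mul continuous_const).measurable
  measurable_invFun := ((continuous_const.mul continuous_id).mul continuous_const).measurable

omit [MeasurableSpace 𝔸] [BorelSpace 𝔸] in
/-- The norm `‖A − V b₀‖` is jointly conjugation-invariant (unitaries act isometrically). [folklore] -/
theorem norm_conj_sub_conj (W : unitary 𝔸) (A x : 𝔸) :
    ‖(W : 𝔸) * A * star (W : 𝔸) - (W : 𝔸) * x * star (W : 𝔸)‖ = ‖A - x‖ := by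
  rw [← sub_mul, ← mul_sub, CStarRing.norm_mul_mem_unitary _ (Unitary.star_mem W.2),
    CStarRing.norm_mem_unitary_mul _ W.2]

/-- (T2) THE HYPOTHESES OF (J-a) HOLD SIMULTANEOUSLY AND NON-TRIVIALLY: `Ω = 𝔸`, `e_W A = W A W⋆`, the
configuration-dependent point mass `ν V = δ_{V b₀ · V b₁}` (covariant: `W V₀ W⋆ · W V₁ W⋆ = W (V₀V₁) W⋆`) and the
non-constant integrand `F X V A = ‖A − V b₀‖` (jointly invariant), on the whole configuration space; hence the
conjugation invariance of `measE ν F X` by `classFn_measE_of_cov`. [folklore] -/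
theorem example_classFn_measE {D : LocDomainSys} {ι : Type*} (b₀ b₁ : ι) (a : ℝ) :
    ∀ X, ∀ W ∈ unitary 𝔸, ∀ V ∈ TubeCfg ι 𝔸 a,
      measE (D := D) (fun V => Measure.dirac (V b₀ * V b₁)) (fun _ V A => ((‖A - V b₀‖ : ℝ) : ℂ)) X
        (fun b => W * V b * star W) =
      measE (D := D) (fun V => Measure.dirac (V b₀ * V b₁)) (fun _ V A => ((‖A - V b₀‖ : ℝ) : ℂ)) X V := by
  refine classFn_measE_of_cov (e := conjEquiv) (fun W V _ => ?_) (fun X W V _ A => ?_)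
  · rw [Measure.map_dirac' (conjEquiv W).measurable]
    congr 1
    show (W : 𝔸) * (V b₀ * V b₁) * star (W : 𝔸) = _
    calc (W : 𝔸) * (V b₀ * V b₁) * star (W : 𝔸)
        = (W : 𝔸) * V b₀ * (star (W : 𝔸) * (W : 𝔸)) * V b₁ * star (W : 𝔸) := by
          rw [Unitary.star_mul_self_of_mem W.2]; noncomm_ring
      _ = (W : 𝔸) * V b₀ * star (W : 𝔸) * ((W : 𝔸) * V b₁ * star (W : 𝔸)) := by noncomm_ring
  · show (((‖(W : 𝔸) * A * star (W : 𝔸) - (W : 𝔸) * V b₀ * star (W : 𝔸)‖ : ℝ) : ℂ)) = _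
    rw [norm_conj_sub_conj]

end Toys

end Literature.MathematicalPhysics.QuantumFieldTheory.Balaban1983to89.B10Eq26MeasureInv
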